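import Summits.BirchSwinnertonDyer.BirchSwinnertonDyer.Theorems.SemiOrdinaryEisensteinDescentJetchevMaxDivisibilityAtThreeModThreeOfMiddleExact
import Summits.BirchSwinnertonDyer.BirchSwinnertonDyer.Theorems.SchneiderFreeAdditiveX3PoitouTateUnramifiedOrthogonalAllLevels
import Literature.NumberTheory.GaloisCohomology.LocalInvariantMapConjCompatible
import HarnessLib

/-!
# Route `SemiOrdinaryEisensteinDescent` rev 19 (act G″): the shared print item `PoitouTateSelmerDualityConjInput`
# (stmt-BirchSwinnertonDyer-23092 = `∀ K, poitouTate_selmerStructure_duality_conj K`, also wanted by PrintX9 / PrintX10b as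
# `PoitouTateSelmerDuality`) from ONE printed statement — Milne *ADT* I Thm. 4.10(b) `Ker γ¹ ⊆ Im β¹` for THE canonical maps —
# and the derived binder PT1 (20461) from it (width seat `bsd-wall-soed-p2-w2` g6; `--supports stmt-BirchSwinnertonDyer-23092`, helper)

After act G″ (pen pss3x g3, rev 19, 2026-08-28T06:44Z) the SOED kernel's duality binder is `hPTc : PoitouTateSelmerDualityConjInput`
(item 23092); `JetchevMaxDivisibilityAtThreeModThree` (25897) and `PoitouTateSelmerStructureDualityFact` (PT1, 20461) are derived from it
(`JetchevMaxOfConjGlue` 26257; `poitouTate_selmerStructure_duality_of_conj`). Of the five conjuncts of 23092's body FOUR are kernel theorems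
for `LocalInvariants.canonical K n` (local Tate duality, reciprocity, Milne I 2.6 at every level, conjugation compatibility); the fifth
(Howard's `SelmerComplement`) follows at every level from the basic middle exactness `hE`
(`PoitouTateReduction.selmerComplement_canonical_of_middleExact_allLevels`). Hence, BY NAME:
* `poitouTateSelmerDualityConjInput_of_selmerComplementCanonical` — 23092 ⟸ `∀ K n, (LocalInvariants.canonical K n).SelmerComplement`;
* `poitouTateSelmerDualityConjInput_of_middleExactCanonical` — **23092 ⟸ `∀ K n, hE (canonical K n)`** (=
  `JetchevMaxDivisibilityAtThreeModThreeOfMiddleExact.poitouTate_conj_forall_of_middleExact_canonical`, re-typed on the item's decl);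
* `poitouTateSelmerStructureDualityFact_of_conjInput` — PT1 (20461) ⟸ 23092 (the `fun` the rev-19 `closes` inlines);
* `poitouTateSelmerStructureDualityFact_of_middleExactCanonical` — PT1 ⟸ hE.
So a future by-name item for `hE` (cells bsd-schneider / bsd-stepL) closes 23092 — hence the duality input of SOED, PrintX9 and PrintX10b —
by one term. CONDITIONAL theorems; no definition, no named fact, no `sorry`; `hE` is NOT proved here; BSD is not proved by any of this.

References: [cite: MilneADT2006, Ch. I, Cor. 2.3, Thm. 2.6, Thm. 4.10(b)] [cite: Howard2004HeegnerKolyvagin, Thm. 2.1.11 (arXiv:1202.6340 p. 6)]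
[cite: Neukirch2013, Ch. III §6] [cite: CasselsFrohlichANT1967, Ch. VII §11].
-/

set_option autoImplicit false
set_option linter.dupNamespace false -- `Summit.BirchSwinnertonDyer.BirchSwinnertonDyer.…` is the tree's layout (D-0017)

noncomputable section

open NumberField IsDedekindDomain

namespace Summit.BirchSwinnertonDyer.BirchSwinnertonDyer.Theorems.PoitouTateSelmerDualityConjInputOfMiddleExact

open Literature.NumberTheory.GaloisRepresentations Literature.NumberTheory.GaloisCohomology
open Literature.NumberTheory.GaloisRepresentations.DiscreteGaloisModule (localTatePairingZMod unramifiedSubgroup)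
open Summit.BirchSwinnertonDyer.BirchSwinnertonDyer.Theses.SemiOrdinaryEisensteinDescent
open Summit.BirchSwinnertonDyer.BirchSwinnertonDyer.Theorems.JetchevMaxDivisibilityAtThreeModThreeOfMiddleExact
  (poitouTate_conj_forall_of_middleExact_canonical)
open Summit.BirchSwinnertonDyer.BirchSwinnertonDyer.Theorems.SchneiderFreeAdditiveX3.PoitouTateReduction
  (unramifiedOrthogonal_of_isPerfect_allLevels)

/-- **Item 23092 `PoitouTateSelmerDualityConjInput` ⟸ Howard's complement property of THE canonical family at every number field and
level** (`SelmerComplement`; Milne I Thm. 4.10(b) `⊇` / Howard 2004 Thm. 2.1.11): `poitouTate_selmerStructure_duality_conj_of_canonical_numberField`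
with its Milne I 2.6 binder discharged (door-c4's `unramifiedOrthogonal_of_isPerfect_allLevels` at `canonical_isPerfect`; the same term as
bsd-stepL's `Koly.poitouTate_conj_forall_of_selmerComplement_canonical`, typed here on the SOED item's decl). CONDITIONAL on `hSC`.
[cite: MilneADT2006, Ch. I, Thm. 2.6 and Thm. 4.10(b)] [cite: Howard2004HeegnerKolyvagin, Thm. 2.1.11 (arXiv:1202.6340 p. 6)] -/
theorem poitouTateSelmerDualityConjInput_of_selmerComplementCanonical
    (hSC : ∀ (K : Type) [Field K] [NumberField K] (n : ℕ) [NeZero n],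
      (LocalInvariants.canonical K n).SelmerComplement) :
    PoitouTateSelmerDualityConjInput :=
  fun K _ _ ↦ poitouTate_selmerStructure_duality_conj_of_canonical_numberField K
    (fun n _ ↦ unramifiedOrthogonal_of_isPerfect_allLevels (LocalInvariants.canonical K n)
      LocalInvariants.canonical_isPerfect) (hSC K)

/-- **Item 23092 `PoitouTateSelmerDualityConjInput` ⟸ ONE printed statement: Milne *ADT* I Thm. 4.10(b), `r = 1`, `Ker γ¹ ⊆ Im β¹`, for
THE canonical maps at every number field `K : Type` and every level `n ≥ 1`** (`hE`, spelled as in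
`PoitouTateReduction.selmerComplement_canonical_of_middleExact_allLevels`). CONDITIONAL on `hE`. [cite: MilneADT2006, Ch. I, Thm. 4.10(b)]
[cite: Neukirch2013, Ch. III §6] [cite: CasselsFrohlichANT1967, Ch. VII §11] -/
theorem poitouTateSelmerDualityConjInput_of_middleExactCanonical
    (hE : ∀ (K : Type) [Field K] [NumberField K] (n : ℕ) [NeZero n],
      ∀ ⦃M : Type⦄ [AddCommGroup M] [TopologicalSpace M] [DiscreteTopology M] [Finite M]
      (ρ : DiscreteGaloisModule K M), (∀ m : M, n • m = 0) →
      ∀ S : Finset (Place K), (∀ w : InfinitePlace K, (Sum.inl w : Place K) ∈ S) →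
        (∀ v : HeightOneSpectrum (𝓞 K), (Sum.inr v : Place K) ∉ S →
          ((n : ℕ) : 𝓞 K) ∉ v.asIdeal ∧ GaloisRep.IsUnramifiedAt v ρ) →
        ∀ t : Π v : Place K, galoisCohomology (ρ.toLocal v) 1,
          (∀ y : galoisCohomology (ρ.tateDual n) 1,
            (∀ v : HeightOneSpectrum (𝓞 K), (Sum.inr v : Place K) ∉ S →
              galoisCohomology.localization (ρ.tateDual n) (Sum.inr v) 1 y ∈
                unramifiedSubgroup (GaloisRep.toLocal v (ρ.tateDual n)) 1) →
            ∑ v ∈ S, localTatePairingZMod ρ n v (LocalInvariants.canonical K n v) (t v)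
              (galoisCohomology.localization (ρ.tateDual n) v 1 y) = 0) →
          ∃ x : galoisCohomology ρ 1,
            (∀ v : HeightOneSpectrum (𝓞 K), (Sum.inr v : Place K) ∉ S →
              galoisCohomology.localization ρ (Sum.inr v) 1 x ∈
                unramifiedSubgroup (GaloisRep.toLocal v ρ) 1) ∧
            ∀ v ∈ S, galoisCohomology.localization ρ v 1 x = t v) :
    PoitouTateSelmerDualityConjInput :=
  poitouTate_conj_forall_of_middleExact_canonical hE

/-- **PT1 `PoitouTateSelmerStructureDualityFact` (20461, the four-conjunct fact at every number field) ⟸ item 23092** — forget the fifth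
conjunct (`poitouTate_selmerStructure_duality_of_conj`); the term the rev-19 `closes` inlines. [cite: MilneADT2006, Ch. I, Thm. 4.10(b)] -/
theorem poitouTateSelmerStructureDualityFact_of_conjInput (hPTc : PoitouTateSelmerDualityConjInput) :
    PoitouTateSelmerStructureDualityFact :=
  fun K _ _ ↦ poitouTate_selmerStructure_duality_of_conj (hPTc K)

/-- **PT1 `PoitouTateSelmerStructureDualityFact` (20461) ⟸ `hE`** (Milne I Thm. 4.10(b) `Ker γ¹ ⊆ Im β¹` for THE canonical maps, every `K`, `n`).
CONDITIONAL on `hE`. [cite: MilneADT2006, Ch. I, Thm. 4.10(b)] -/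
theorem poitouTateSelmerStructureDualityFact_of_middleExactCanonical
    (hE : ∀ (K : Type) [Field K] [NumberField K] (n : ℕ) [NeZero n],
      ∀ ⦃M : Type⦄ [AddCommGroup M] [TopologicalSpace M] [DiscreteTopology M] [Finite M]
      (ρ : DiscreteGaloisModule K M), (∀ m : M, n • m = 0) →
      ∀ S : Finset (Place K), (∀ w : InfinitePlace K, (Sum.inl w : Place K) ∈ S) →
        (∀ v : HeightOneSpectrum (𝓞 K), (Sum.inr v : Place K) ∉ S →
          ((n : ℕ) : 𝓞 K) ∉ v.asIdeal ∧ GaloisRep.IsUnramifiedAt v ρ) →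
        ∀ t : Π v : Place K, galoisCohomology (ρ.toLocal v) 1,
          (∀ y : galoisCohomology (ρ.tateDual n) 1,
            (∀ v : HeightOneSpectrum (𝓞 K), (Sum.inr v : Place K) ∉ S →
              galoisCohomology.localization (ρ.tateDual n) (Sum.inr v) 1 y ∈
                unramifiedSubgroup (GaloisRep.toLocal v (ρ.tateDual n)) 1) →
            ∑ v ∈ S, localTatePairingZMod ρ n v (LocalInvariants.canonical K n v) (t v)
              (galoisCohomology.localization (ρ.tateDual n) v 1 y) = 0) →
          ∃ x : galoisCohomology ρ 1,
            (∀ v : HeightOneSpectrum (𝓞 K), (Sum.inr v : Place K) ∉ S →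
              galoisCohomology.localization ρ (Sum.inr v) 1 x ∈
                unramifiedSubgroup (GaloisRep.toLocal v ρ) 1) ∧
            ∀ v ∈ S, galoisCohomology.localization ρ v 1 x = t v) :
    PoitouTateSelmerStructureDualityFact :=
  poitouTateSelmerStructureDualityFact_of_conjInput (poitouTateSelmerDualityConjInput_of_middleExactCanonical hE)

end Summit.BirchSwinnertonDyer.BirchSwinnertonDyer.Theorems.PoitouTateSelmerDualityConjInputOfMiddleExact

end
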